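import Summits.BirchSwinnertonDyer.BirchSwinnertonDyer.Theorems.ResidualThetaTransportAtTwoDefs
import Summits.BirchSwinnertonDyer.BirchSwinnertonDyer.Theorems.EisensteinPrimesUnramifiedLeAwayKer
import Summits.BirchSwinnertonDyer.BirchSwinnertonDyer.Theorems.EisensteinPrimesAcTwistDeformationCotorsion
import Summits.BirchSwinnertonDyer.BirchSwinnertonDyer.Theorems.TwoAdicConverseOrdLambdaHalfAtTwoGreenbergCotorsionCyclotomic
import Literature.NumberTheory.EllipticCurves.KatoFineSelmerDual
import Literature.NumberTheory.EllipticCurves.CyclotomicZpExtensionUnramifiedAwayPProofs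
import Literature.NumberTheory.EllipticCurves.GreenbergSelmerDualDataExistsProofs
import Summits.BirchSwinnertonDyer.BirchSwinnertonDyer.Theorems.ResidualThetaTransportAtTwoResidualSignedLambdaLowerCMAtTwoCofreeSelmerTransfer
import Summits.BirchSwinnertonDyer.Rank1Residual.X11b.BDPRouteLocalNonsingularBridge
import Literature.NumberTheory.EllipticCurves.NeronOggShafarevichLocal
import Mathlib.Algebra.Module.CharacterModule
import Mathlib.LinearAlgebra.TensorProduct.Tower
import HarnessLib

/-!
# Sketch (sidea k2 g33) — the CONSUMER KIT of the «Kato125AB» port (S170 (β)): H-STAB, H-ISO and two thirds of H-SEL in kernel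

Stub-ideation seat `sidea-stub_cmLambdaLower-2-g33` (technique family: literature transfer / tree match), crux
`ResidualThetaCountLowerPureAtTwo` (stmt-BirchSwinnertonDyer-26074), stub `stub_cmLambdaLower` (bt26_lambda v8 = RSL_g's text, CLOSED MOD
PRINT; residue = child B's print body «Kato125AB», rows 113/116 of STUB-PLAN rev 33.1). Row 113's PRICE and Q173 L7 / Q174 name three
consumer helpers the port of the merged fact needs and NOBODY has proved: H-STAB (S), H-ISO (S), H-SEL (M). This file proves, sorry-free:

* §1 H-STAB (generic `K`, `H`, `M`, `R`): scalars preserve Greenberg's STRICT local condition and the strict Selmer group, hence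
  `scalarH1_mem_fineSelmerInfty` — the `Module 𝒪 ↥X` / `hXO` binder of the typed text is then constructible (L7).
* §2 H-SEL, generic third: the fine strict condition at `v` IS local triviality on `H ⊓ D_v` (`strictKer (fineLocalDatum M v) H = awayKer H M v`),
  so `Sel₀(K_∞, M)` = «locally trivial at every place» (`mem_fineSelmerInfty_iff_locallyTrivial`).
* §3 H-ISO: `lamO_congr`, `lamO_characterModule_congr` (`LinearEquiv.baseChange`, `CharacterModule.congr`).
* §4 H-SEL, away-from-`2` third (TREE MATCH): over the cyclotomic `ℤ₂`-tower of `ℚ`, for `A_ρ = CofreeF S ρ`, «unramified = locally trivial»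
  at every `w ∤ 2` — the tree's engine `UnramifiedLeAwayKer.unramifiedKer_le_awayKer_of_not_decomp_le` (cell bsd-eis) fed with FOUR tree inputs
  (`isOpen_stabilizer_cofree`, `exists_pow_smul_cofree_eq_zero`, `greenbergInertia_le_kerSubgroup_of_isCyclotomic`,
  `TwoAdicGreenbergCotorsion.not_decomp_le_kerSubgroup_of_isCyclotomic`); and the `S₀`-split of the registered texts
  (`unramifiedOutside 2·S₀` ∧ unramified at `S₀` ⟺ locally trivial at all `w ∤ 2`).
* §6 H-SEL, at-`2` third: the AT-`2` KUMMER BRIDGE `kummerTorsionAtTwo_iff_mem_awayKer` (`Sel₀`'s torsion-Kummer clause through `Θ` ⟺ local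
  triviality above `2`; bricks B2 `exists_rep_vanishing_of_resOfLe_inf_eq_zero`, B-LOC `resGalOfEmb_closureEmb_mem_decomp` /
  `exists_eq_resGalOfEmb_of_mem_decomp`, L-TORS `exists_pointsMapOfEmb_eq_of_nsmul_eq_zero`, `pointsMapOfEmb_smul` / `_injective`).
* §5/§7 H-SEL assembled over the pin bundle `π : OnePairPins …`: `mem_Sel₀_iff_mem_fineSelmerInfty_closed` (membership in the pinned `Sel₀` =
  membership in `GreenbergSelmer.fineSelmerInfty (CofreeF S ρ) κ`), `mem_plusSelmerSet_of_mem_fineSelmerInfty` (fine ⟹ signed) and the port's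
  shape `exists_Sel₀_coe_eq_iff_mem_fineSelmerInfty` = k2-g31's ☐ (H-SEL, M) signature — NO hypothesis beyond the habitat's.

Nothing is asserted as a fact; no `sorry`; no instance / notation. BSD is NOT proved by any of this; 22608 / 26074 stay OPEN.

References: Greenberg 1989 §1 p. 98 ("replace `I_v` by `D_v` … `D_v/I_v` has profinite order prime to `p`"); Greenberg–Vatsal 2000 §2 p. 17;
Emerton–Pollack–Weston 2006 §3.1; Kato 2004 §13.8 (λ-invariants); Burungale–Tian 2026 §2 (Selmer structures at `p = 2`).
-/

set_option autoImplicit false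
set_option linter.dupNamespace false

noncomputable section

open scoped Classical TensorProduct

universe u

namespace Summit.BirchSwinnertonDyer.BirchSwinnertonDyer.Cruxes.ResidualThetaCountLowerPureAtTwo.SideaK2G33

open NumberField IsDedekindDomain Field
open Literature.NumberTheory.EllipticCurves Literature.NumberTheory.EllipticCurves.GreenbergSelmer
  Literature.NumberTheory.EllipticCurves.GreenbergVatsal2000 Literature.NumberTheory.GaloisRepresentations

/-! ## §1 H-STAB — scalars preserve the strict condition, the strict Selmer group and `Sel₀(K_∞, M)` -/

section HStab

variable {K : Type u} [Field K] [NumberField K]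
variable (H : Subgroup (absoluteGaloisGroup K)) {M : Type u} [AddCommGroup M]
  [DistribMulAction (absoluteGaloisGroup K) M] {R : Type*} [Monoid R] [DistribMulAction R M]
  [SMulCommClass (absoluteGaloisGroup K) R M]

/-- The scalar endomorphism of `M ⧸ M⁺_v` commutes with the action of `H ⊓ D_v` (the tree's `grScalarHom_smul` is stated for
`H ⊓ I_v`; same proof). [cite: EmertonPollackWeston2006, §3.1] -/
theorem grScalarHom_smul_decompIn {v : HeightOneSpectrum (𝓞 K)} (N : LocalDatum K M v) (r : R)
    (hr : ∀ m ∈ N.plus, r • m ∈ N.plus) (x : decompIn H v) (q : N.Gr) :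
    N.grScalarHom r hr (x • q) = x • N.grScalarHom r hr q := by
  obtain ⟨m, rfl⟩ := N.grMk_surjective q
  change N.grScalarHom r hr ((x : decomp (K := K) v) • N.grMk m) =
    (x : decomp (K := K) v) • N.grScalarHom r hr (N.grMk m)
  rw [N.smul_grMk, N.grScalarHom_grMk, N.grScalarHom_grMk, N.smul_grMk,
    smul_comm ((x : decomp (K := K) v) : absoluteGaloisGroup K) r m]

variable [TopologicalSpace M] [DiscreteTopology M]

/-- **The strict local map commutes with scalars**: for `r` preserving `M⁺_v`, `strictMap ∘ scalarH1 r = H¹(r) ∘ strictMap`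
(both induced by the compatible pair (`H ⊓ D_v ↪ H`, `m ↦ (r • m) mod M⁺_v`)). [cite: NeukirchSchmidtWingberg2008, I.§5] -/
theorem strictMap_comp_scalarH1 {v : HeightOneSpectrum (𝓞 K)} (N : LocalDatum K M v) (r : R)
    (hr : ∀ m ∈ N.plus, r • m ∈ N.plus) :
    (N.strictMap H).comp (scalarH1 H M r) =
      (resH1Hom (ContinuousMonoidHom.id (decompIn H v)) (N.grScalarHom r hr)
        (fun x q ↦ grScalarHom_smul_decompIn H N r hr x q)).comp (N.strictMap H) := by
  rw [scalarH1, LocalDatum.strictMap, resH1Hom_comp, resH1Hom_comp]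
  exact resH1Hom_congr (by ext; rfl) (by ext; rfl) _ _

/-- Scalars preserving `M⁺_v` preserve Greenberg's STRICT local condition at `v`. [cite: Greenberg1989, §1 p. 98] -/
theorem scalarH1_mem_strictKer {v : HeightOneSpectrum (𝓞 K)} (N : LocalDatum K M v) (r : R)
    (hr : ∀ m ∈ N.plus, r • m ∈ N.plus) {c : subgroupH1 H M} (hc : c ∈ N.strictKer H) :
    scalarH1 H M r c ∈ N.strictKer H := by
  rw [LocalDatum.mem_strictKer_iff, ← AddMonoidHom.comp_apply, strictMap_comp_scalarH1 H N r hr,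
    AddMonoidHom.comp_apply, (N.mem_strictKer_iff H c).1 hc, map_zero]

/-- **Scalars preserve Greenberg's strict Selmer group** (the `𝒪`-module structure of `Sel^{str}(L, A)`).
[cite: EmertonPollackWeston2006, §3.1] [cite: Greenberg1989, §1 p. 98] -/
theorem scalarH1_mem_strictSelmerGroupOver [H.Normal] {p : ℕ} {L : Data K M p} (r : R)
    (hr : ∀ (v : HeightOneSpectrum (𝓞 K)) (hv : ((p : ℕ) : 𝓞 K) ∈ v.asIdeal),
      ∀ m ∈ (L v hv).plus, r • m ∈ (L v hv).plus)
    {c : subgroupH1 H M} (hc : c ∈ strictSelmerGroupOver H M p L) :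
    scalarH1 H M r c ∈ strictSelmerGroupOver H M p L := by
  have e : ∀ σ : absoluteGaloisGroup K,
      conjH1 H M σ (scalarH1 H M r c) = scalarH1 H M r (conjH1 H M σ c) :=
    fun σ ↦ by rw [← AddMonoidHom.comp_apply, conjH1_comp_scalarH1, AddMonoidHom.comp_apply]
  rw [mem_strictSelmerGroupOver_iff] at hc ⊢
  refine ⟨fun v hv σ ↦ ?_, fun w σ ↦ ?_, fun v hv σ ↦ ?_⟩
  · rw [e]; exact scalarH1_mem_awayKer H M v r (hc.1 v hv σ)
  · rw [e]; exact scalarH1_mem_infKer H M w r (hc.2.1 w σ)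
  · rw [e]; exact scalarH1_mem_strictKer H (L v hv) r (hr v hv) (hc.2.2 v hv σ)

/-- **H-STAB.** `Sel₀(K_∞, M)` is stable under every scalar `r` commuting with `Γ_K` (the fine datum `M⁺_v = 0` is preserved by anything):
the `𝒪`-module structure of the fine Selmer group / of the binder `X` of the «Kato125AB» text (its `hXO` clause), Q173 L7.
[cite: EmertonPollackWeston2006, §3.1] [cite: Greenberg1989, §1 p. 98] -/
theorem scalarH1_mem_fineSelmerInfty {p : ℕ} [Fact p.Prime] (κ : ZpExtension K p) (r : R)
    {c : subgroupH1 κ.kerSubgroup M} (hc : c ∈ GreenbergSelmer.fineSelmerInfty M κ) :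
    scalarH1 κ.kerSubgroup M r c ∈ GreenbergSelmer.fineSelmerInfty M κ := by
  rw [GreenbergSelmer.fineSelmerInfty_eq, GreenbergSelmer.strictSelmerInfty] at hc ⊢
  refine scalarH1_mem_strictSelmerGroupOver κ.kerSubgroup r (fun v hv m hm ↦ ?_) hc
  change m ∈ (GreenbergSelmer.fineLocalDatum M v).plus at hm
  change r • m ∈ (GreenbergSelmer.fineLocalDatum M v).plus
  rw [GreenbergSelmer.fineLocalDatum_plus, AddSubgroup.mem_bot] at hm ⊢
  rw [hm, smul_zero]

end HStab

/-! ## §2 H-SEL (generic third) — the fine strict condition at `v` is local triviality on `H ⊓ D_v` -/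

section FineIsLocallyTrivial

variable {K : Type u} [Field K] [NumberField K]
variable (H : Subgroup (absoluteGaloisGroup K)) (M : Type u) [AddCommGroup M]
  [DistribMulAction (absoluteGaloisGroup K) M] [TopologicalSpace M] [DiscreteTopology M]

/-- The restriction `H¹(H, M) → H¹(H ⊓ D_v, M)` written on the subgroup `decompIn H v ≤ D_v`. [folklore] -/
def resDecompIn (v : HeightOneSpectrum (𝓞 K)) : subgroupH1 H M →+ discreteH1 (decompIn H v) M :=
  resH1Hom (decompInToH H v) (AddMonoidHom.id M) fun _ _ ↦ rfl

/-- The tautological continuous surjection `decompIn H v ↠ H ⊓ D_v` (same elements, two ambient groups). [folklore] -/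
def decompInToInf (v : HeightOneSpectrum (𝓞 K)) : decompIn H v →ₜ* ↥(H ⊓ decomp (K := K) v) where
  toFun z := ⟨((z : decomp (K := K) v) : absoluteGaloisGroup K),
    Subgroup.mem_inf.2 ⟨(mem_decompIn_iff H v _).1 z.2, (z : decomp (K := K) v).2⟩⟩
  map_one' := rfl
  map_mul' _ _ := rfl
  continuous_toFun := (continuous_subtype_val.comp continuous_subtype_val).subtype_mk _

omit [TopologicalSpace M] [DiscreteTopology M] in
theorem decompInToInf_surjective (v : HeightOneSpectrum (𝓞 K)) : Function.Surjective (decompInToInf H v) := by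
  rintro ⟨z, hz⟩
  obtain ⟨hzH, hzD⟩ := Subgroup.mem_inf.1 hz
  exact ⟨⟨⟨z, hzD⟩, (mem_decompIn_iff H v _).2 hzH⟩, rfl⟩

/-- `resDecompIn = res_{decompIn ↠ H ⊓ D_v} ∘ resOfLe` (functoriality). [folklore] -/
theorem resDecompIn_eq_comp (v : HeightOneSpectrum (𝓞 K)) :
    resDecompIn H M v =
      (resH1Hom (decompInToInf H v) (AddMonoidHom.id M) fun _ _ ↦ rfl).comp
        (resOfLe M (inf_le_left : H ⊓ decomp (K := K) v ≤ H)) := by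
  rw [resDecompIn, resOfLe, resH1Hom_comp]
  exact resH1Hom_congr (by ext; rfl) (by ext; rfl) _ _

/-- `ker resDecompIn = awayKer` (inflation along the surjection `decompIn ↠ H ⊓ D_v` is injective). [folklore] -/
theorem resDecompIn_eq_zero_iff (v : HeightOneSpectrum (𝓞 K)) (c : subgroupH1 H M) :
    resDecompIn H M v c = 0 ↔ c ∈ awayKer H M v := by
  rw [awayKer, AddMonoidHom.mem_ker, resDecompIn_eq_comp, AddMonoidHom.comp_apply]
  constructor
  · intro h
    exact Summit.BirchSwinnertonDyer.Rank1Residual.Iwasawa.resH1Hom_injective_of_surjective (M := M)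
      (decompInToInf H v) (decompInToInf_surjective H v) (fun _ _ ↦ rfl) (by rw [h, map_zero])
  · intro h
    rw [h, map_zero]

/-- The fine strict map factors: `strictMap (M⁺ = 0) = H¹(M → M ⧸ 0) ∘ resDecompIn`. [cite: Greenberg1989, §1 p. 98] -/
theorem strictMap_fine_eq_comp (v : HeightOneSpectrum (𝓞 K)) :
    (GreenbergSelmer.fineLocalDatum M v).strictMap H =
      (resH1Hom (ContinuousMonoidHom.id (decompIn H v)) (GreenbergSelmer.fineLocalDatum M v).grMk
        (fun x m ↦ ((GreenbergSelmer.fineLocalDatum M v).smul_grMk (x : decomp (K := K) v) m).symm)).comp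
        (resDecompIn H M v) := by
  rw [resDecompIn, LocalDatum.strictMap, resH1Hom_comp]
  exact resH1Hom_congr (by ext; rfl) (by ext; rfl) _ _

/-- The inverse of `M → M ⧸ 0` as an additive homomorphism (the fine datum has `M⁺_v = ⊥` definitionally). [folklore] -/
def grInvFine (v : HeightOneSpectrum (𝓞 K)) : (GreenbergSelmer.fineLocalDatum M v).Gr →+ M :=
  QuotientAddGroup.lift (⊥ : AddSubgroup M) (AddMonoidHom.id M) (by
    intro m hm; rw [AddSubgroup.mem_bot] at hm; simp [hm])

omit [TopologicalSpace M] [DiscreteTopology M] in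
@[simp] theorem grInvFine_grMk (v : HeightOneSpectrum (𝓞 K)) (m : M) :
    grInvFine M v ((GreenbergSelmer.fineLocalDatum M v).grMk m) = m := rfl

omit [TopologicalSpace M] [DiscreteTopology M] in
theorem grInvFine_smul (v : HeightOneSpectrum (𝓞 K)) (x : decompIn H v) (q : (GreenbergSelmer.fineLocalDatum M v).Gr) :
    grInvFine M v (x • q) = x • grInvFine M v q := by
  obtain ⟨m, rfl⟩ := (GreenbergSelmer.fineLocalDatum M v).grMk_surjective q
  change grInvFine M v ((x : decomp (K := K) v) • (GreenbergSelmer.fineLocalDatum M v).grMk m) = _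
  rw [(GreenbergSelmer.fineLocalDatum M v).smul_grMk, grInvFine_grMk, grInvFine_grMk]
  rfl

/-- `H¹(M → M ⧸ 0)` is injective on `H¹(decompIn H v, –)` (it has the left inverse `H¹(M ⧸ 0 → M)`). [folklore] -/
theorem resH1Hom_grMk_fine_injective (v : HeightOneSpectrum (𝓞 K)) :
    Function.Injective (resH1Hom (ContinuousMonoidHom.id (decompIn H v)) (GreenbergSelmer.fineLocalDatum M v).grMk
        (fun x m ↦ ((GreenbergSelmer.fineLocalDatum M v).smul_grMk (x : decomp (K := K) v) m).symm) :
      discreteH1 (decompIn H v) M → discreteH1 (decompIn H v) (GreenbergSelmer.fineLocalDatum M v).Gr) := by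
  have hcomp : (resH1Hom (ContinuousMonoidHom.id (decompIn H v)) (grInvFine M v)
        (fun x q ↦ grInvFine_smul H M v x q)).comp
      (resH1Hom (ContinuousMonoidHom.id (decompIn H v)) (GreenbergSelmer.fineLocalDatum M v).grMk
        (fun x m ↦ ((GreenbergSelmer.fineLocalDatum M v).smul_grMk (x : decomp (K := K) v) m).symm)) =
      AddMonoidHom.id _ := by
    rw [resH1Hom_comp, ← resH1Hom_id]
    exact resH1Hom_congr (by ext; rfl) (by ext; rfl) _ _
  intro a b hab
  have := congrArg (resH1Hom (ContinuousMonoidHom.id (decompIn H v)) (grInvFine M v)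
    (fun x q ↦ grInvFine_smul H M v x q)) hab
  rwa [← AddMonoidHom.comp_apply, ← AddMonoidHom.comp_apply, hcomp] at this

/-- **The fine strict condition at `v` is local triviality on `H ⊓ D_v`**: `strictKer (M⁺_v = 0) = awayKer` ("replace `I_v` by `D_v`":
for the datum `0` Greenberg's strict condition reads `res_{D_w}[c] = 0`). [cite: Greenberg1989, §1 p. 98] [cite: Kim2022StructureSelmer, §1.2.4] -/
theorem strictKer_fineLocalDatum_eq_awayKer (v : HeightOneSpectrum (𝓞 K)) :
    (GreenbergSelmer.fineLocalDatum M v).strictKer H = awayKer H M v := by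
  ext c
  rw [LocalDatum.mem_strictKer_iff, strictMap_fine_eq_comp, AddMonoidHom.comp_apply, ← resDecompIn_eq_zero_iff]
  constructor
  · intro h
    exact resH1Hom_grMk_fine_injective H M v (by rw [h, map_zero])
  · intro h
    rw [h, map_zero]

/-- **`Sel₀(K_∞, M)` = the classes locally trivial at EVERY place** (finite places: all conjugates in `awayKer`; infinite: `infKer`).
[cite: Greenberg1989, §1 p. 98] [cite: Kim2022StructureSelmer, §1.2.4 and Conj. 1.3] -/
theorem mem_fineSelmerInfty_iff_locallyTrivial {p : ℕ} [Fact p.Prime] (κ : ZpExtension K p) (c : subgroupH1 κ.kerSubgroup M) :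
    c ∈ GreenbergSelmer.fineSelmerInfty M κ ↔
      (∀ (v : HeightOneSpectrum (𝓞 K)) (σ : absoluteGaloisGroup K), conjH1 κ.kerSubgroup M σ c ∈ awayKer κ.kerSubgroup M v) ∧
        ∀ (w : InfinitePlace K) (σ : absoluteGaloisGroup K), conjH1 κ.kerSubgroup M σ c ∈ infKer κ.kerSubgroup M w := by
  rw [GreenbergSelmer.fineSelmerInfty_eq, GreenbergSelmer.strictSelmerInfty, mem_strictSelmerGroupOver_iff]
  constructor
  · rintro ⟨h1, h2, h3⟩
    refine ⟨fun v σ ↦ ?_, h2⟩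
    by_cases hv : ((p : ℕ) : 𝓞 K) ∈ v.asIdeal
    · have h := h3 v hv σ
      change conjH1 κ.kerSubgroup M σ c ∈ (GreenbergSelmer.fineLocalDatum M v).strictKer κ.kerSubgroup at h
      rwa [strictKer_fineLocalDatum_eq_awayKer] at h
    · exact h1 v hv σ
  · rintro ⟨h1, h2⟩
    refine ⟨fun v _ σ ↦ h1 v σ, h2, fun v hv σ ↦ ?_⟩
    change conjH1 κ.kerSubgroup M σ c ∈ (GreenbergSelmer.fineLocalDatum M v).strictKer κ.kerSubgroup
    rw [strictKer_fineLocalDatum_eq_awayKer]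
    exact h1 v σ

end FineIsLocallyTrivial

/-! ## §3 H-ISO — `λ_𝒪` is invariant under `𝒪`-linear equivalence (and under `CharacterModule.congr`) -/

section HIso

open Summit.BirchSwinnertonDyer.BirchSwinnertonDyer.Theorems.OnePair

variable {p : ℕ} [Fact p.Prime] (S : Set (PadicAlgCl p))

/-- **H-ISO.** `λ_𝒪(X) = λ_𝒪(Y)` for `X ≃ₗ[𝒪] Y` (`Frac 𝒪 ⊗_𝒪 –` is a functor; `LinearEquiv.finrank_eq`). [cite: Kato2004Asterisque, §13.8 (p. 228)] -/
theorem lamO_congr {X Y : Type*} [AddCommGroup X] [Module (coeffO S) X] [AddCommGroup Y] [Module (coeffO S) Y]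
    (e : X ≃ₗ[coeffO S] Y) : lamO S X = lamO S Y :=
  LinearEquiv.finrank_eq (LinearEquiv.baseChange (coeffO S) (FractionRing (coeffO S)) X Y e)

/-- **H-ISO for Pontryagin duals.** `λ_𝒪(X^∨) = λ_𝒪(Y^∨)` for `X ≃ₗ[𝒪] Y` (`CharacterModule.congr`). [cite: Kato2004Asterisque, §13.8 (p. 228)] -/
theorem lamO_characterModule_congr {X Y : Type*} [AddCommGroup X] [Module (coeffO S) X] [AddCommGroup Y]
    [Module (coeffO S) Y] (e : X ≃ₗ[coeffO S] Y) : lamO S (CharacterModule X) = lamO S (CharacterModule Y) :=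
  lamO_congr S (CharacterModule.congr e)

/-- The `Module.Finite` clause of (FINX) transports the same way. [cite: Kato2004Asterisque, §13.8 (p. 228)] -/
theorem moduleFinite_characterModule_congr {X Y : Type*} [AddCommGroup X] [Module (coeffO S) X] [AddCommGroup Y]
    [Module (coeffO S) Y] (e : X ≃ₗ[coeffO S] Y)
    (h : Module.Finite (FractionRing (coeffO S)) (TensorProduct (coeffO S) (FractionRing (coeffO S)) (CharacterModule X))) :
    Module.Finite (FractionRing (coeffO S)) (TensorProduct (coeffO S) (FractionRing (coeffO S)) (CharacterModule Y)) :=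
  Module.Finite.equiv (LinearEquiv.baseChange (coeffO S) (FractionRing (coeffO S)) _ _ (CharacterModule.congr e))

end HIso

/-! ## §4 H-SEL (away-from-`2` third) — «unramified = locally trivial» at `w ∤ 2` over `ℚ_∞` for `A_ρ`, and the `S₀`-split -/

section HSelAway

open Summit.BirchSwinnertonDyer.BirchSwinnertonDyer.Theorems.OnePair
open Summit.BirchSwinnertonDyer.BirchSwinnertonDyer.Theorems

variable (S : Set (PadicAlgCl 2)) (κ : ZpExtension ℚ 2) (ρ : FramedGaloisRep ℚ ↥(padicCoeffIntegers S) 2)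

/-- **Unramified = locally trivial at `w ∤ 2` over the cyclotomic `ℤ₂`-tower, for `A_ρ = F²/𝒪²`** — TREE MATCH: the bsd-eis engine
`unramifiedKer_le_awayKer_of_not_decomp_le` (pro-prime-to-`2` quotient `Gal(ℚ̄_w/ℚ_{∞,η})/I_w`) with its four hypotheses discharged by name
(open stabilisers and `2`-primarity of `Cofree ρ F`; `I_w ≤ Γ_∞` and `D_w ≰ Γ_∞` for the CYCLOTOMIC tower), plus the trivial converse.
[cite: Greenberg1989, §1 p. 98] [cite: GreenbergVatsal2000, §2 p. 17] -/
theorem unramifiedKer_eq_awayKer_of_isCyclotomic (hκ : κ.IsCyclotomic) {w : HeightOneSpectrum (𝓞 ℚ)}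
    (hw : ((2 : ℕ) : 𝓞 ℚ) ∉ w.asIdeal) :
    unramifiedKer κ.kerSubgroup (CofreeF S ρ) w = awayKer κ.kerSubgroup (CofreeF S ρ) w :=
  le_antisymm
    (UnramifiedLeAwayKer.unramifiedKer_le_awayKer_of_not_decomp_le κ (isOpen_stabilizer_cofree S ρ)
      (exists_pow_smul_cofree_eq_zero S ρ)
      (Literature.NumberTheory.EllipticCurves.ZpExtension.greenbergInertia_le_kerSubgroup_of_isCyclotomic κ hκ hw)
      (TwoAdicGreenbergCotorsion.not_decomp_le_kerSubgroup_of_isCyclotomic κ hκ w))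
    (AcTwistDeformation.awayKer_le_unramifiedKer κ.kerSubgroup w)

/-- **The `S₀`-split of the registered texts.** For `S₀ ∌ (places above 2)`: «locally trivial at every `w ∤ 2` (all conjugates)» ⟺
«unramified outside `2·S₀`» (the `Sg`/`plusSelmerSet` clause (1)) ∧ «unramified at `S₀`» (the `Sel₀` primitivity clause).
[cite: GreenbergVatsal2000, §2 pp. 16–17, 23] [cite: Kato2004Asterisque, Thm. 12.5 (2) (p. 222)] -/
theorem forall_awayKer_iff_unramified (hκ : κ.IsCyclotomic) (S₀ : Finset (HeightOneSpectrum (𝓞 ℚ)))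
    (hS₀ : ∀ v ∈ S₀, ((2 : ℕ) : 𝓞 ℚ) ∉ v.asIdeal) (y : H1Γ S κ ρ) :
    (∀ w : HeightOneSpectrum (𝓞 ℚ), ((2 : ℕ) : 𝓞 ℚ) ∉ w.asIdeal →
        ∀ σ : absoluteGaloisGroup ℚ, conjH1 κ.kerSubgroup (CofreeF S ρ) σ y ∈ awayKer κ.kerSubgroup (CofreeF S ρ) w) ↔
      (y ∈ unramifiedOutside κ.kerSubgroup (CofreeF S ρ) 2 (↑S₀ : Set (HeightOneSpectrum (𝓞 ℚ))) ∧
        ∀ w ∈ S₀, ∀ σ : absoluteGaloisGroup ℚ,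
          conjH1 κ.kerSubgroup (CofreeF S ρ) σ y ∈ unramifiedKer κ.kerSubgroup (CofreeF S ρ) w) := by
  constructor
  · intro h
    refine ⟨(mem_unramifiedOutside_iff _).2 fun v _ hv2 σ ↦ ?_, fun w hw σ ↦ ?_⟩
    · rw [unramifiedKer_eq_awayKer_of_isCyclotomic S κ ρ hκ hv2]; exact h v hv2 σ
    · rw [unramifiedKer_eq_awayKer_of_isCyclotomic S κ ρ hκ (hS₀ w hw)]; exact h w (hS₀ w hw) σ
  · rintro ⟨h1, h2⟩ w hw2 σ
    rw [← unramifiedKer_eq_awayKer_of_isCyclotomic S κ ρ hκ hw2]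
    by_cases hwS : w ∈ S₀
    · exact h2 w hwS σ
    · exact (mem_unramifiedOutside_iff _).1 h1 w (fun h ↦ hwS (Finset.mem_coe.1 h)) hw2 σ

end HSelAway

/-! ## §6 H-SEL (at-`2` third) — the torsion Kummer clause of `Sel₀` IS local triviality above `2` -/

section AtTwo

open Summit.BirchSwinnertonDyer.BirchSwinnertonDyer.Theorems.OnePair
open Summit.BirchSwinnertonDyer.BirchSwinnertonDyer.Theorems

variable (S : Set (PadicAlgCl 2)) (W : WeierstrassCurve ℚ) [W.IsElliptic] (κ : ZpExtension ℚ 2) (n : ℕ)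
  (ρ : FramedGaloisRep ℚ ↥(padicCoeffIntegers S) 2)
  (Θ : ∀ v : HeightOneSpectrum (𝓞 ℚ), ((2 : ℕ) : 𝓞 ℚ) ∈ v.asIdeal → (Cofree ρ ↥(padicCoeffField S) ≃+ (Fin n → ↥(W.geomPrimaryTorsion 2))))

/-- **The AT-`2` KUMMER BRIDGE (H-SEL's last third).** For a place `v' ∣ 2` and a class `y ∈ H¹(Γ_∞, A_ρ)`: the `Sel₀` pin's clause at
`v'` — «a representative cocycle whose `Θ`-coordinates, read in `E(ℚ̄_{v'})`, are the Kummer cocycle `τ ↦ τQ − Q` of `2`-power TORSION local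
points `Q` on `Γ_∞ ∩ Γ_{ℚ_{v'}}`» — holds IFF `y` is LOCALLY TRIVIAL above `v'` (`y ∈ awayKer Γ_∞ A_ρ v'`).
(⇐) B2: a class dying on `Γ_∞ ⊓ D_{v'}` has a representative VANISHING there (`exists_rep_vanishing_of_resOfLe_inf_eq_zero`), and `res_ι τ ∈ D_{v'}`
(`resGalOfEmb_closureEmb_mem_decomp`), so `Q = 0`, `k = 0` work. (⇒) the torsion local points are images of geometric `2`-power torsion points
(`exists_pointsMapOfEmb_eq_of_nsmul_eq_zero`, AEC III.6.4), `P ∈ E[2^∞]ⁿ` pulls back through `Θ` to `m ∈ A_ρ`, and by the equivariance `hΘ`,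
`pointsMapOfEmb_smul`/`_injective` and `D_{v'} = res_ι(Γ_{ℚ_{v'}})` (`exists_eq_resGalOfEmb_of_mem_decomp`) the cocycle IS the coboundary of
`m` on `Γ_∞ ⊓ D_{v'}` (`CocycleCriteria.resOfLe_oneCocycleClass_eq_zero_iff`).
[cite: Greenberg1989, §1 p. 98 (the strict condition)] [cite: SerreGaloisCohomology1997, I §2.6 (b)] [cite: SilvermanAEC2009, Cor. III.6.4(b)] -/
theorem kummerTorsionAtTwo_iff_mem_awayKer
    (hΘ : ∀ v hv (δ : absoluteGaloisGroup (v.adicCompletion ℚ)) m i,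
      Θ v hv (resGalOfEmb (closureEmb (K := ℚ) (v.adicCompletion ℚ)) δ • m) i =
        resGalOfEmb (closureEmb (K := ℚ) (v.adicCompletion ℚ)) δ • Θ v hv m i)
    (v' : HeightOneSpectrum (𝓞 ℚ)) (hv' : ((2 : ℕ) : 𝓞 ℚ) ∈ v'.asIdeal) (y : H1Γ S κ ρ) :
    (∃ (φ : contOneCocycles (discreteTopRep ↥κ.kerSubgroup (Cofree ρ ↥(padicCoeffField S))))
        (Q : Fin n → localPoints W (v'.adicCompletion ℚ)) (k : ℕ),
        oneCocycleClass (discreteTopRep ↥κ.kerSubgroup (Cofree ρ ↥(padicCoeffField S))) φ = y ∧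
        (∀ i, (2 ^ k) • Q i ∈ (⊥ : AddSubgroup (localPoints W (v'.adicCompletion ℚ)))) ∧
        ∀ (τ : ↥(localSubgroupOfEmb κ.kerSubgroup (closureEmb (K := ℚ) (v'.adicCompletion ℚ)))) (i : Fin n),
          pointsMapOfEmb W (closureEmb (K := ℚ) (v'.adicCompletion ℚ))
            ((Θ v' hv' (φ.1 (resGalSubgroupOfEmb κ.kerSubgroup (closureEmb (K := ℚ) (v'.adicCompletion ℚ)) τ)) i :
              ↥(W.geomPrimaryTorsion 2)) : W.geomPoints) = (τ : absoluteGaloisGroup (v'.adicCompletion ℚ)) • Q i - Q i) ↔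
      y ∈ awayKer κ.kerSubgroup (CofreeF S ρ) v' := by
  constructor
  · rintro ⟨φ, Q, k, hφ, hQ, hτ⟩
    have hQ0 : ∀ i, 2 ^ k • Q i = 0 := fun i ↦ (AddSubgroup.mem_bot).1 (hQ i)
    choose P hP2 hPQ using fun i ↦ exists_pointsMapOfEmb_eq_of_nsmul_eq_zero W (closureEmb (K := ℚ) (v'.adicCompletion ℚ))
      (pow_ne_zero k two_ne_zero) (hQ0 i)
    have hPmem : ∀ i, P i ∈ W.geomPrimaryTorsion 2 := fun i ↦ AddCommGroup.mem_primaryComponent.2 ⟨k, hP2 i⟩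
    let T : Fin n → ↥(W.geomPrimaryTorsion 2) := fun i ↦ ⟨P i, hPmem i⟩
    rw [awayKer, AddMonoidHom.mem_ker, ← hφ, CocycleCriteria.resOfLe_oneCocycleClass_eq_zero_iff]
    refine ⟨(Θ v' hv').symm T, fun x ↦ ?_⟩
    obtain ⟨hxH, hxD⟩ := Subgroup.mem_inf.1 x.2
    obtain ⟨τ₀, hτ₀⟩ := Summit.BirchSwinnertonDyer.Rank1Residual.X11b.AcSelmer.exists_eq_resGalOfEmb_of_mem_decomp v' hxD
    have hτU : τ₀ ∈ localSubgroupOfEmb κ.kerSubgroup (closureEmb (K := ℚ) (v'.adicCompletion ℚ)) := by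
      rw [mem_localSubgroupOfEmb_iff, hτ₀]; exact hxH
    have hincl : Subgroup.inclusion (inf_le_left : κ.kerSubgroup ⊓ decomp (K := ℚ) v' ≤ κ.kerSubgroup) x =
        resGalSubgroupOfEmb κ.kerSubgroup (closureEmb (K := ℚ) (v'.adicCompletion ℚ)) ⟨τ₀, hτU⟩ :=
      Subtype.ext (by rw [resGalSubgroupOfEmb_apply_coe, hτ₀]; rfl)
    have hx : (x : absoluteGaloisGroup ℚ) = resGalOfEmb (closureEmb (K := ℚ) (v'.adicCompletion ℚ)) τ₀ := hτ₀.symm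
    apply (Θ v' hv').injective
    funext i
    apply Subtype.ext
    apply pointsMapOfEmb_injective W (closureEmb (K := ℚ) (v'.adicCompletion ℚ))
    rw [hincl, hτ ⟨τ₀, hτU⟩ i, map_sub, Pi.sub_apply, AddSubgroup.coe_sub, map_sub, hx, hΘ, primaryComponent.coe_smul,
      pointsMapOfEmb_smul, AddEquiv.apply_symm_apply]
    change (τ₀ : absoluteGaloisGroup (v'.adicCompletion ℚ)) • Q i - Q i =
      τ₀ • pointsMapOfEmb W (closureEmb (K := ℚ) (v'.adicCompletion ℚ)) (P i) -
        pointsMapOfEmb W (closureEmb (K := ℚ) (v'.adicCompletion ℚ)) (P i)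
    rw [hPQ]
  · intro hy
    rw [awayKer, AddMonoidHom.mem_ker] at hy
    obtain ⟨ψ, hψ, hvan⟩ := ThetaTransport.CofreeSelmerTransfer.exists_rep_vanishing_of_resOfLe_inf_eq_zero κ.kerSubgroup
      (decomp (K := ℚ) v') (isOpen_stabilizer_cofree S ρ) hy
    refine ⟨ψ, 0, 0, hψ, fun i ↦ by rw [Pi.zero_apply, smul_zero]; exact AddSubgroup.zero_mem _, fun τ i ↦ ?_⟩
    have h0 : ψ.1 (resGalSubgroupOfEmb κ.kerSubgroup (closureEmb (K := ℚ) (v'.adicCompletion ℚ)) τ) = 0 :=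
      hvan _ (by
        rw [resGalSubgroupOfEmb_apply_coe]
        exact Summit.BirchSwinnertonDyer.Rank1Residual.X11b.AcSelmer.resGalOfEmb_closureEmb_mem_decomp v' _)
    rw [h0, map_zero, Pi.zero_apply, ZeroMemClass.coe_zero, map_zero, Pi.zero_apply, smul_zero, sub_zero]

end AtTwo

/-! ## §5→§7 H-SEL assembled over the pin bundle -/

section HSel

open Summit.BirchSwinnertonDyer.BirchSwinnertonDyer.Theorems.OnePair
open Summit.BirchSwinnertonDyer.BirchSwinnertonDyer.Theorems

variable (S : Set (PadicAlgCl 2)) (W : WeierstrassCurve ℚ) [W.IsElliptic] (κ : ZpExtension ℚ 2) (γ : absoluteGaloisGroup ℚ)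
  (S₀ : Finset (HeightOneSpectrum (𝓞 ℚ))) (n : ℕ) (ρ : FramedGaloisRep ℚ ↥(padicCoeffIntegers S) 2)
  (Θ : ∀ v : HeightOneSpectrum (𝓞 ℚ), ((2 : ℕ) : 𝓞 ℚ) ∈ v.asIdeal → (Cofree ρ ↥(padicCoeffField S) ≃+ (Fin n → ↥(W.geomPrimaryTorsion 2))))
  (hΘ : ∀ v hv (δ : absoluteGaloisGroup (v.adicCompletion ℚ)) m i,
    Θ v hv (resGalOfEmb (closureEmb (K := ℚ) (v.adicCompletion ℚ)) δ • m) i = resGalOfEmb (closureEmb (K := ℚ) (v.adicCompletion ℚ)) δ • Θ v hv m i)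
  (I : Kato2004.IwasawaH1DataCoeff (FramedGaloisRep.toGaloisRep ρ) 2 κ γ)
  (Sg : AddSubgroup (subgroupH1 κ.kerSubgroup (Cofree ρ ↥(padicCoeffField S)))) [Module ↥(padicCoeffIntegers S) ↥Sg]

/-- **H-SEL modulo the at-`2` bridge.** With `Sg` pinned to the signed Selmer set (the registered `hSg` binder), `S₀` away from `2`, `κ`
cyclotomic, and `A` := the AT-`2` clause of `OnePairPins.mem_Sel₀_iff` (torsion Kummer datum through `Θ`, all conjugates — passed abstractly
with its defining `hA := π.mem_Sel₀_iff`) bridged to local triviality above `2` (`hAt2`, the one remaining M-piece): membership in the pinned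
`Sel₀` IS membership in the tree's fine Selmer group `Sel₀(ℚ_∞, A_ρ)` — the `hX` binder of the «Kato125AB» text for `X := Sg ⊓ {Sel₀}`.
[cite: Kato2004Asterisque, Thm. 12.5 (2) (p. 222)] [cite: Greenberg1989, §1 p. 98] [cite: GreenbergVatsal2000, §2 p. 17] -/
theorem mem_Sel₀_iff_mem_fineSelmerInfty (hκ : κ.IsCyclotomic) (hS₀ : ∀ v ∈ S₀, ((2 : ℕ) : 𝓞 ℚ) ∉ v.asIdeal)
    (hSg : ∀ y : H1Γ S κ ρ, y ∈ Sg ↔ y ∈ plusSelmerSet S W κ S₀ n ρ Θ)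
    (π : OnePairPins S W κ γ S₀ n ρ Θ hΘ I Sg) (A : ↥Sg → Prop)
    (hA : ∀ s : ↥Sg, s ∈ π.Sel₀ ↔ A s ∧ ∀ w ∈ S₀, ∀ σ : absoluteGaloisGroup ℚ,
      conjH1 κ.kerSubgroup (CofreeF S ρ) σ (s : H1Γ S κ ρ) ∈ unramifiedKer κ.kerSubgroup (CofreeF S ρ) w)
    (hAt2 : ∀ s : ↥Sg, A s ↔ ∀ (v' : HeightOneSpectrum (𝓞 ℚ)), ((2 : ℕ) : 𝓞 ℚ) ∈ v'.asIdeal → ∀ σ : absoluteGaloisGroup ℚ,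
      conjH1 κ.kerSubgroup (CofreeF S ρ) σ (s : H1Γ S κ ρ) ∈ awayKer κ.kerSubgroup (CofreeF S ρ) v')
    (s : ↥Sg) :
    s ∈ π.Sel₀ ↔ (s : H1Γ S κ ρ) ∈ GreenbergSelmer.fineSelmerInfty (CofreeF S ρ) κ := by
  have hs : (s : H1Γ S κ ρ) ∈ plusSelmerSet S W κ S₀ n ρ Θ := (hSg _).1 s.2
  obtain ⟨hunr, hinf, -⟩ := hs
  rw [hA, hAt2, mem_fineSelmerInfty_iff_locallyTrivial]
  constructor
  · rintro ⟨h2, hS0⟩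
    refine ⟨fun v σ ↦ ?_, hinf⟩
    by_cases hv : ((2 : ℕ) : 𝓞 ℚ) ∈ v.asIdeal
    · exact h2 v hv σ
    · exact (forall_awayKer_iff_unramified S κ ρ hκ S₀ hS₀ (s : H1Γ S κ ρ)).2 ⟨hunr, hS0⟩ v hv σ
  · rintro ⟨haw, -⟩
    exact ⟨fun v hv σ ↦ haw v σ,
      ((forall_awayKer_iff_unramified S κ ρ hκ S₀ hS₀ (s : H1Γ S κ ρ)).1 fun w hw σ ↦ haw w σ).2⟩

/-- **H-SEL, COMPLETE (the `hX` binder of the «Kato125AB» text, for `X := {s ∈ Sg | s ∈ Sel₀}`).** On the habitat of child B / RSL_g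
(`κ` cyclotomic, `S₀` away from `2`, `Sg` pinned to the signed Selmer set by `hSg`), membership in the pinned strict-and-primitive `Sel₀` IS
membership in the tree's fine Selmer group `Sel₀(ℚ_∞, A_ρ) = GreenbergSelmer.fineSelmerInfty (CofreeF S ρ) κ`: §5 with `A :=` the pin's own
at-`2` clause (`hA := π.mem_Sel₀_iff`) and the at-`2` Kummer bridge §6 — no hypothesis left.
[cite: Kato2004Asterisque, Thm. 12.5 (2) (p. 222)] [cite: Greenberg1989, §1 p. 98] [cite: Kim2022StructureSelmer, §1.2.4] -/
theorem mem_Sel₀_iff_mem_fineSelmerInfty_closed (hκ : κ.IsCyclotomic) (hS₀ : ∀ v ∈ S₀, ((2 : ℕ) : 𝓞 ℚ) ∉ v.asIdeal)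
    (hSg : ∀ y : H1Γ S κ ρ, y ∈ Sg ↔ y ∈ plusSelmerSet S W κ S₀ n ρ Θ)
    (π : OnePairPins S W κ γ S₀ n ρ Θ hΘ I Sg) (s : ↥Sg) :
    s ∈ π.Sel₀ ↔ (s : H1Γ S κ ρ) ∈ GreenbergSelmer.fineSelmerInfty (CofreeF S ρ) κ := by
  refine mem_Sel₀_iff_mem_fineSelmerInfty S W κ γ S₀ n ρ Θ hΘ I Sg hκ hS₀ hSg π _ (fun s ↦ π.mem_Sel₀_iff s)
    (fun s ↦ ?_) s
  constructor
  · intro h v' hv' σ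
    exact (kummerTorsionAtTwo_iff_mem_awayKer S W κ n ρ Θ hΘ v' hv' _).1 (h v' hv' σ)
  · intro h v' hv' σ
    exact (kummerTorsionAtTwo_iff_mem_awayKer S W κ n ρ Θ hΘ v' hv' _).2 (h v' hv' σ)

omit [W.IsElliptic] in
/-- **`Sel₀(ℚ_∞, A_ρ) ⊆ 𝒮` (fine ⟹ signed):** a class locally trivial everywhere lies in the signed Selmer set — unramified outside `2·S₀` by §4,
trivial at `∞` by definition, and at `v ∣ 2` the PLUS Kummer clause holds with the ZERO points (`Q = 0 ∈ ⨆_m E⁺(ℚ_{m,v})`, `k = 0`) for a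
representative vanishing on `Γ_∞ ⊓ D_v` (B2). [cite: Greenberg1989, §1 p. 98 (3)] [cite: Kobayashi2003, Def. 1.1] [cite: SerreGaloisCohomology1997, I §2.6 (b)] -/
theorem mem_plusSelmerSet_of_mem_fineSelmerInfty (hκ : κ.IsCyclotomic) (y : H1Γ S κ ρ)
    (hy : y ∈ GreenbergSelmer.fineSelmerInfty (CofreeF S ρ) κ) : y ∈ plusSelmerSet S W κ S₀ n ρ Θ := by
  rw [mem_fineSelmerInfty_iff_locallyTrivial] at hy
  obtain ⟨haw, hinf⟩ := hy
  refine ⟨(mem_unramifiedOutside_iff _).2 fun v _ hv2 σ ↦ ?_, hinf, fun v hv σ ↦ ?_⟩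
  · rw [unramifiedKer_eq_awayKer_of_isCyclotomic S κ ρ hκ hv2]; exact haw v σ
  · have h := haw v σ
    rw [awayKer, AddMonoidHom.mem_ker] at h
    obtain ⟨ψ, hψ, hvan⟩ := ThetaTransport.CofreeSelmerTransfer.exists_rep_vanishing_of_resOfLe_inf_eq_zero κ.kerSubgroup
      (decomp (K := ℚ) v) (isOpen_stabilizer_cofree S ρ) h
    refine ⟨ψ, 0, 0, hψ, fun i ↦ by rw [Pi.zero_apply, smul_zero]; exact zero_mem _, fun τ i ↦ ?_⟩
    have h0 : ψ.1 (resGalSubgroupOfEmb κ.kerSubgroup (closureEmb (K := ℚ) (v.adicCompletion ℚ)) τ) = 0 :=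
      hvan _ (by
        rw [resGalSubgroupOfEmb_apply_coe]
        exact Summit.BirchSwinnertonDyer.Rank1Residual.X11b.AcSelmer.resGalOfEmb_closureEmb_mem_decomp v _)
    rw [h0, map_zero, Pi.zero_apply, ZeroMemClass.coe_zero, map_zero, Pi.zero_apply, smul_zero, sub_zero]

/-- **H-SEL IN THE PORT'S SHAPE (k2-g31's ☐ (H-SEL, M) signature, now ✓):** for `X :=` the image of the pinned `Sel₀` in `H¹(Γ_∞, A_ρ)`,
`y ∈ X ↔ y ∈ Sel₀(ℚ_∞, A_ρ)` — the `hX` binder of the «Kato125AB» text, with NO hypothesis beyond the habitat's (`κ` cyclotomic, `S₀ ∌ 2`, `hSg`).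
[cite: Kato2004Asterisque, Thm. 12.5 (2) (p. 222)] [cite: Greenberg1989, §1 p. 98] -/
theorem exists_Sel₀_coe_eq_iff_mem_fineSelmerInfty (hκ : κ.IsCyclotomic) (hS₀ : ∀ v ∈ S₀, ((2 : ℕ) : 𝓞 ℚ) ∉ v.asIdeal)
    (hSg : ∀ y : H1Γ S κ ρ, y ∈ Sg ↔ y ∈ plusSelmerSet S W κ S₀ n ρ Θ)
    (π : OnePairPins S W κ γ S₀ n ρ Θ hΘ I Sg) (y : H1Γ S κ ρ) :
    (∃ s : ↥Sg, s ∈ π.Sel₀ ∧ (s : H1Γ S κ ρ) = y) ↔ y ∈ GreenbergSelmer.fineSelmerInfty (CofreeF S ρ) κ := by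
  constructor
  · rintro ⟨s, hs, rfl⟩
    exact (mem_Sel₀_iff_mem_fineSelmerInfty_closed S W κ γ S₀ n ρ Θ hΘ I Sg hκ hS₀ hSg π s).1 hs
  · intro hy
    have hySg : y ∈ Sg := (hSg y).2 (mem_plusSelmerSet_of_mem_fineSelmerInfty S W κ S₀ n ρ Θ hκ y hy)
    exact ⟨⟨y, hySg⟩, (mem_Sel₀_iff_mem_fineSelmerInfty_closed S W κ γ S₀ n ρ Θ hΘ I Sg hκ hS₀ hSg π ⟨y, hySg⟩).2 hy, rfl⟩

/-- **The `𝒪`-linear identification consumed by H-ISO**: the pinned `Sel₀` (an `𝒪`-submodule of `↥Sg`) is `𝒪`-linearly equivalent to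
ITSELF read through any `𝒪`-linear equivalence — recorded here only as the shape the port uses: `lamO_characterModule_congr S e` with
`e : ↥π.Sel₀ ≃ₗ[𝒪] ↥X` turns `λ_𝒪(X^∨)` of (LAM)/(FINX) into child B's `λ_𝒪((π.Sel₀)^∨)`. [cite: Kato2004Asterisque, §13.8 (p. 228)] -/
theorem lamO_Sel₀_dual_eq_of_linearEquiv (π : OnePairPins S W κ γ S₀ n ρ Θ hΘ I Sg) {X : Type*} [AddCommGroup X]
    [Module (coeffO S) X] (e : ↥π.Sel₀ ≃ₗ[coeffO S] X) :
    lamO S (CharacterModule ↥π.Sel₀) = lamO S (CharacterModule X) :=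
  lamO_characterModule_congr S e

end HSel

end Summit.BirchSwinnertonDyer.BirchSwinnertonDyer.Cruxes.ResidualThetaCountLowerPureAtTwo.SideaK2G33

end
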